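import Literature.NumberTheory.DiophantineApproximation.PolylogTwoPointHermitePade
import HarnessLib

/-!
# Type-I Hermite–Padé forms for the shifted polylogarithms `∑ y^{k+1}/(mk+r)^s` (`r ≤ m`, `s ≤ w`) — vocabulary

Topic `Literature/NumberTheory/DiophantineApproximation`. The `m`-shift generalisation of the parity programme
`PolylogTwoPointHermitePade*.lean` (`m = 2`): for integers `m ≥ 2`, `w ≥ 1` and a large integer `M`, the
`mw + 1` numbers `1` and

  `Φ_{s,r}(1/M) = ∑_{k ≥ 0} M^{−k−1}/(mk + r)^s`   (`1 ≤ r ≤ m`, `1 ≤ s ≤ w`)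

(`lerchShift m r s`; `Φ_{s,m} = m^{−s} Li_s`, and for `m = 2`, `Φ_{s,1} = Θ_s = oddPolylogSeries s`) are linearly
independent over `ℚ` — the Lerch-function / distinct-shifts form of the Nikišin–Hata–David–Hirata-Kohno–Kawashima
theorem (shifts `r/m`), which through `Li_s(ζx) = ∑_r ζ^r x^{r−m} Φ_{s,r}(x^m)` (`ζ^m = 1`) controls the polylogarithms
at the points `ζ/N`; over `ℝ`, `m = 4` gives `1, Li_s(1/N), Li_s(−1/N), Li_s(−1/N²)` (the duplication tower of height
two of the Kontsevich–Zagier box sectors). The type-I kernel is the numerator of the one-point kernel placed over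
the Ball–Rivoal pole set in the variable `t = mu`:

  `K^{(m,w)}_n(u) = m^{2wn} (u − wn + 1)_{wn} / (mu + 1)_{n+1}^w`   (`kernelM m w n u`),

with the poles `t = −1, …, −(n+1)` of multiplicity `w` and the roots `t = 0, m, 2m, …, m(wn − 1)`; summed over the
naturals `u` only, `Λ_n(y) = ∑_u K(u) y^{u+1}` (`formM`) is `O((m² y)^{wn})` while its partial fraction expansion
`K(u) = ∑_{p ≤ n} ∑_{o < w} c_{o,p}/(mu+p+1)^{o+1}` makes `Λ_n(1/M)` a linear form in `1` and the `Φ_{o+1,r}(1/M)`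
(pole index `p` with `p % m + 1 = r`, since `mu + p + 1 = m(u + p/m) + r`) with coefficients polynomial in `M` of
degree `≤ n/m` (`coefM`, `constM`) — the ratio `w : 1/m` of smallness to height is what closes Nesterenko's criterion
with `mw` irrationals. In `t` the kernel is the product of the `w` bricks `m^{2n}(t/m − (s+1)n + 1)_n/(t+1)_{n+1}`
whose residues `resM m n s μ` at `t = −μ−1` are the integers `(−1)^{n+μ} C(n,μ) E_m(μ+1+msn, n)`,
`E_m(q, n) = m^n q(q+m)⋯(q+(n−1)m)/n!` (`stepBinomM m q n`, the Taylor coefficients of `(1 − m²x)^{−q/m}`; that `n!`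
divides `m^n q(q+m)⋯(q+(n−1)m)` — Legendre's formula on an arithmetic progression whose step is `m` — is proved in
the sibling Bricks file; here the definition uses natural-number division).

This file only fixes the VOCABULARY (definitions, no facts): `stepBinomM`, `resM`, `kernelM`, `lerchShift`,
`formM`, `coefM`, `constM`.

References: S. David, N. Hirata-Kohno, M. Kawashima, *Can polylogarithms at algebraic points be linearly
independent?*, Moscow J. Comb. Number Th. 9 (2020), Thm 2.1 [DavidHirataKohnoKawashima2020] (one shift);
S. David, N. Hirata-Kohno, M. Kawashima, *Linear independence criteria for generalized polylogarithms with
distinct shifts*, arXiv:2010.09167 (distinct shifts); E. M. Nikišin, Mat. Sb. 109 (1979); M. Hata, J. Math.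
Pures Appl. 69 (1990); T. Rivoal, C. R. Acad. Sci. Paris 331 (2000), §2 (the brick mechanism).
-- TODO(general form): algebraic points and the effective thresholds of the cited papers.
-/

noncomputable section

open Finset

namespace Literature.NumberTheory.DiophantineApproximation

namespace ShiftPade

open Literature.NumberTheory.Transcendental

/-- The `m`-step binomial numbers `E_m(q, n) = m^n · q (q+m) (q+2m) ⋯ (q+(n−1)m) / n!`, the Taylor coefficients of
`(1 − m² x)^{−q/m}` (`E_2 = ParityPade.stepTwoBinom`), defined by natural-number division; the divisibility
`n! ∣ m^n ∏_{i<n} (q + m i)` (Legendre on an arithmetic progression of step `m`) is proved in the Bricks file.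
[folklore] -/
def stepBinomM (m q n : ℕ) : ℕ := (m ^ n * ∏ i ∈ range n, (q + m * i)) / n.factorial

/-- The integer residues of the `m`-shift brick `s`,
`m^{2n} (t/m − (s+1)n + 1)_n / (t+1)_{n+1} = ∑_{μ ≤ n} (resM m n s μ)/(t + μ + 1)`:
`resM m n s μ = (−1)^{n+μ} C(n, μ) E_m(μ + 1 + msn, n)`. [folklore] -/
def resM (m n s μ : ℕ) : ℤ :=
  (-1) ^ (n + μ) * (n.choose μ : ℤ) * (stepBinomM m (μ + 1 + m * s * n) n : ℤ)

/-- The `m`-shift kernel `K^{(m,w)}_n(u) = m^{2wn} (u − wn + 1)_{wn} / (mu + 1)_{n+1}^w`: the numerator of the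
one-point kernel `PolylogPade.kernelW w n` over the Ball–Rivoal denominator in the variable `t = mu` (poles
`t = −1, …, −(n+1)`, roots `t ∈ mℕ`, `t < mwn`), a rational function of `u : ℚ` (junk value at the poles, never used).
For `m = 2` this is `ParityPade.kernelH w n u`. [cite: DavidHirataKohnoKawashima2020, Thm 2.1] -/
def kernelM (m w n : ℕ) (u : ℚ) : ℚ :=
  (m : ℚ) ^ (2 * (w * n)) * BallRivoal.poch (u - w * n + 1) (w * n) / BallRivoal.poch (m * u + 1) (n + 1) ^ w

/-- The shifted polylogarithm-type series `Φ_{s,r}(y) = ∑_{k ≥ 0} y^{k+1}/(mk + r)^s` (absolutely convergent for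
`|y| < 1`; `Φ_{s,m}(y) = m^{−s} Li_s(y)`, and `Li_s(ζ x) = ∑_{r=1}^{m} ζ^r x^{r−m} Φ_{s,r}(x^m)` for `ζ^m = 1`).
[folklore] -/
def lerchShift (m r s : ℕ) (y : ℝ) : ℝ := ∑' k : ℕ, y ^ (k + 1) / ((m : ℝ) * k + r) ^ s

/-- The `m`-shift form `Λ^{(m,w)}_n(y) = ∑_{u ≥ 0} K^{(m,w)}_n(u) y^{u+1}` (a real `tsum` over the naturals `u`,
i.e. over the values `t ∈ mℕ`; absolutely convergent for `|y| < 1` since `0 ≤ K ≤ m^{2wn}` at the naturals).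
[cite: DavidHirataKohnoKawashima2020, Thm 2.1] -/
def formM (m w n : ℕ) (y : ℝ) : ℝ := ∑' u : ℕ, (kernelM m w n u : ℝ) * y ^ (u + 1)

/-- The coefficient of `Φ_{o+1,r}(1/M)` in `Λ^{(m,w)}_n(1/M)` attached to partial-fraction data `c` (coefficient
`c o p` of `1/(t+p+1)^{o+1}`, `t = mu`): the pole indices `p` with `p % m + 1 = r` contribute, since
`mu + p + 1 = m(u + p/m) + (p % m + 1)` and `∑_u M^{−u−1}/(m(u+i)+r)^s = M^i (Φ_{s,r}(1/M) − ∑_{k<i} M^{−k−1}/(mk+r)^s)`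
(`i = p/m`, natural division): `∑_{p ≤ n, p % m + 1 = r} c_{o,p} M^{p/m}`. [folklore] -/
def coefM (n m : ℕ) (c : ℕ → ℕ → ℚ) (M o r : ℕ) : ℚ :=
  ∑ p ∈ range (n + 1), if p % m + 1 = r then c o p * (M : ℚ) ^ (p / m) else 0

/-- The constant term of `Λ^{(m,w)}_n(1/M)` attached to partial-fraction data `c` (the finite remainders of the
shift identity): `−∑_{o<w} ∑_{p≤n} c_{o,p} ∑_{k<p/m} M^{p/m}/(M^{k+1} (mk + p % m + 1)^{o+1})`. [folklore] -/
def constM (n m w : ℕ) (c : ℕ → ℕ → ℚ) (M : ℕ) : ℚ :=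
  -∑ o ∈ range w, ∑ p ∈ range (n + 1),
    c o p * ∑ k ∈ range (p / m), (M : ℚ) ^ (p / m) / ((M : ℚ) ^ (k + 1) * ((m : ℚ) * k + (p % m + 1)) ^ (o + 1))


/-- The constant term of `Λ^{(m,w)}_n(1/M)` attached to partial-fraction data `c`, CORRECT form (the finite
remainders of the shift identity): `−∑_{o<w} ∑_{p≤n} c_{o,p} ∑_{k<p/m} M^{p/m}/(M^{k+1} (mk + (p % m) + 1)^{o+1})`,
with the residue `p % m + 1` computed in `ℕ` and then cast. It SUPERSEDES `constM` above, whose text lets the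
binary-operator elaborator read `p % m` in `ℚ` — the Euclidean-domain remainder of a field, identically `0` — so
that `constM` carries the denominators `(mk + 1)^{o+1}` instead; `constM` is kept only for the record and is not
used by the sibling files. [folklore] -/
def constShift (n m w : ℕ) (c : ℕ → ℕ → ℚ) (M : ℕ) : ℚ :=
  -∑ o ∈ range w, ∑ p ∈ range (n + 1),
    c o p * ∑ k ∈ range (p / m),
      (M : ℚ) ^ (p / m) / ((M : ℚ) ^ (k + 1) * ((m : ℚ) * k + ((p % m + 1 : ℕ) : ℚ)) ^ (o + 1))

/-- Sanity check of the corrected constant term: with all data equal to `1`, `m = 2`, `n = 3`, `w = 1`, `M = 1`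
the only nonzero remainders come from `p = 2` (`k = 0`, residue `1`: denominator `1`) and `p = 3` (`k = 0`,
residue `2`: denominator `2`), so `constShift 3 2 1 1 1 = −(1 + 1/2) = −3/2` (whereas the superseded `constM`
gives `−2`). [folklore] -/
theorem constShift_example : constShift 3 2 1 (fun _ _ => 1) 1 = -3 / 2 := by
  unfold constShift
  norm_num [Finset.sum_range_succ]

end ShiftPade

end Literature.NumberTheory.DiophantineApproximation
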